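import Summits.CriticalPhenomena.PercolationContinuityZ3.Theses.PercNearOneGluing
import Literature.Probability.Percolation.PercolationProofs

/-!
# Line `replica-splice-at-entrance` — skeleton for the crux `PercNearOneGluing.AdditiveGluing`

Crux item stmt-CriticalPhenomena-4576 (route `route-CriticalPhenomena-PercNearOneGluing`, rank 5; sub-problem
`PercolationContinuityZ3`); idea `replica-splice-at-entrance` (crux-ideate round 1, ideator k = 1; triage r1-1/2/3:
pass / pass-with-doubt / pass-with-doubt — "identity-level; name the load-bearing inequality"); crux-plan by
planner-cruxplan-stmt-CriticalPhenomena-4576-replica-splice-at-en-0, 2026-08-16.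

Crux (FIXED, concluded BY NAME below): on every finite weighted graph (`μ = prodBernoulli w` on the bond configurations of
the complete graph on `Fin n`, events `openConn`), for `0 ≤ t` and `P(a ↔ b) ≥ 1 − t` for all `a ∈ A`:
`P(o ↔ A) − t ≤ P(o ↔ b)`.

Notation in the docstrings. `ρ(v) = P(v ↔ b)` (`rel`); `A_s = {v | ρ(v) ≥ s}` the superlevel set / reliability ball
around `b` (`levelSet`; `b ∈ A_s` for `s ≤ 1`); for a relay set `A`: the `A`-AVOIDING POCKET `W(ω)` of `o` = the vertices
joined to `o` by open paths inside `Aᶜ` (`pocket`), the ENTRANCE SET / first contacts `N(ω) ⊆ A` = points of `A` reached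
from `o` by an open path meeting `A` only at its end (`contacts`; `N ≠ ∅ ↔ o ↔ A`), `a_N = argmin_{a ∈ N} ρ` the WORST first
contact, `m(N) = ρ(a_N)` (`minRel`), `G ∖ W` = weights of all pairs meeting `W` set to `0` (`delV`), and
`Z(W, N) = P_{G∖W}(N ↔ b)`.

## The line in one paragraph

Explore the cluster of `o` WITHOUT entering the ball `A = A_s` (the level-set normal form, KN §5.6(4)); stop at the
entrance: what is revealed is the pocket data `(W, N)` — all pairs meeting `W`. (i) On `{pocket = W, N}` one has
`o ↔ b` iff some first contact reaches `b` OFF the pocket (last-exit decomposition, `stub_lastExitCut`); (ii) the pairs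
off `W` are FRESH — the Gladkov–Zimin splice `ω₁ →_F ω₂` at the stopping set `F = {pairs meeting W}` has law `μ`
(arXiv:2408.08457 Lemma 3.1 = GZ24 Lemma 4.2) — so `P(pocket = (W,N), o ↔ b) = P(pocket = (W,N)) · Z(W,N)`
(`stub_pocketMarkov`); (iii) THE BET (`stub_replicaEntrance`, two-replica form of the averaged entrance inequality):
`Σ_{(W,N)} P(pocket = (W,N)) · [Z(W,N) − ρ(a_N)] ≥ 0`, i.e. for two INDEPENDENT percolations
`P⊗P[a_{N(ω₁)} ↔ b in ω₂] ≤ P⊗P[N(ω₁) ↔ b in ω₂ off W(ω₁)]` — the worst first contact of `ω₁`'s pocket is less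
likely to reach `b` in the replica than the whole entrance set is to reach `b` in the replica without crossing
`ω₁`'s pocket ("Cost ≤ Gain": Cost = replica paths of `a_N` that reach `b` only THROUGH the pocket's territory, Gain =
another first contact succeeds off-pocket while `a_N` fails). Summing (i)–(iii) over the pocket data gives the
FIRST-CONTACT BOUND `P(o ↔ b) ≥ E[min_{a ∈ N} ρ(a); o ↔ A_s]` (`firstContactBound`, proved here from the stubs), which
is KN Conjecture 1 for level sets with the minimum taken over FIRST CONTACTS only (stronger than Conj 1, hence than the
crux: `E[min_N ρ; o ↔ A_{1−t}] ≥ (1−t) P(o ↔ A_{1−t}) ≥ P(o ↔ A) − t`; the composition `AdditiveGluing_of` is that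
real proof, with the partition of the configuration space by pocket data and the first-entrance inclusion
`{o ↔ A} ⊆ {N ≠ ∅}` proved in this file).

Why this and not the card's entrance TIME: the averaged entrance inequality with a SEQUENTIAL exploration stopped at
its first `A`-vertex `u_T` (`E[Z_T − ρ(u_T); T < ∞] ≥ 0`) is FALSE for fixed-order DFS (71/293 exact instances, n ≤ 5),
BFS (73/293), reliability-worst-first DFS (8/293) and best-first DFS (144/293) — e.g. path `b –0.8– o –0.8– x`,
`A = {b, x, ·}`: entering at `b` first leaves no surplus to pay for the dead branch `u_T = x` (`Z_T = 0 < ρ(x) = 0.64`);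
only the FULL pocket with the WORST first contact survives (0 violations, see Numerics). Charging the BEST first contact
(`max_N ρ`) is false (152/293), charging per pocket `W` separately is false (≈ 10 % of pockets, already `W = {o}` when
`o` has non-`A` neighbours: the dead pocket in its simplest form), and the deletion–contraction recursion at an edge of
`o` has a negative exact residual in 21/375 cases (no edge-local induction; cf. KN Thm 13) — so the cross-pocket
averaging in (iii) is essential and is where a proof must transport mass from small dead pockets to the larger pockets
obtained by OPENING the scar edge hit by the replica path (the swap-at-`e` involution of Gladkov's Thm 4.3 proof; in a
digraph opening the scar arc does not grow the forward pocket — the directed analogue of (iii) fails on KN's Fig. 4: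
`15/32 > 14/32` — so the reversal of the scar edge is where the symmetry of `↔` is spent).

## Disproof used (cdisprove v1/v2 on the item; `Disproof.lean` bodies are not mounted in planner seats — read through
the evidence notes and TRIAGE-r1-3 §"Disproof.lean used", as the triagers did; no `Theorems/AdditiveGluing/Negative/`
lemma has landed, nothing to import)
* `0 ≤ t needed (only via A = ∅)` / `relay hypothesis needed`: honoured — the composition spends `0 ≤ t` exactly at
  `b ∈ A_{1−t}` (`ρ(b) = 1 ≥ 1 − t`) and at `(1−t)·P ≥ P − t`, and the relay hypothesis exactly at `A ⊆ A_{1−t}`;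
  no stub carries `t`.
* tightness `o ∈ A is the equality case`: for `o ∈ A_s`, `N = {o}` and (iii) is the identity `0 = 0`; the composition's
  only losses are `A ⊆ A_{1−t}` and `(1−t)P ≥ P − t`.
* refuted strengthening `average instead of max`: (iii) charges the MINIMUM reliability over first contacts (the
  max-unreliability side), never an average; the `max_N ρ` charging is recorded false above.
* refuted strengthening `DIRECTED analogue of AG` (5 vertices, 19/64 > 18/64; KN §5.7 Fig. 4): the directed analogue of
  (iii) is false on Fig. 4 itself (computed: `E[ρ⃗(a_N)] = 15/32 > P(o → b) = 7/16`), so a proof of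
  `stub_replicaEntrance` must use reversibility — located at the scar-edge swap (above).
* `any counterexample has |A| ≥ 3`, `A = superlevel set WLOG`: (iii) is filed for superlevel sets only; with ONE relay
  besides `b` it is Harris' inequality (`{a ∈ N}` increasing, `{a ↮ b}` decreasing), so its first open case is two relays
  + `b`, matching the Disproof's floor.

## Numerics (planner, this session; exact enumeration over all `2^m` configurations, pure Python, folder `lab/`)
(iii)/`firstContactBound` for GENERAL `A` (not only level sets): 0 violations in ≈ 30 000 random weighted instances
`n ≤ 7` (7 weight regimes incl. near-one `{.9,…,.999}`, bimodal, uniform-½) + ≈ 4 700 at `n = 8` + all level sets and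
all "star" instances (`o` isolated in `G ∖ A`) of those graphs; adversarial logit hill-climbs on `K₅`, `K₆` and random
6–7-vertex topologies (≈ 300 restarts, weights in `[.05,.95]` and `[.001,.999]`): infimum of the relative slack `→ 0⁺`
only on the degenerate gluing locus `o ≡ relay` (weights → 1), never negative. Controls that FAIL as expected: best
first contact, sequential entrance vertex (DFS/BFS/worst-first), per-pocket positivity, edge-at-`o` recursion residual.

## Stubs (3, registered) and composition
* `stub_lastExitCut` (M; combinatorics of walks): `{pocket = (W,N)} ∩ {o ↔ b} = {pocket = (W,N)} ∩ {∃ a ∈ N, a ↔ b in Wᶜ}`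
  for `b ∈ A`.
* `stub_pocketMarkov` (M–L; product-measure calculus = the splice at the entrance stopping set):
  `μ({pocket = (W,N)} ∩ {∃ a ∈ N, a ↔ b in Wᶜ}) = μ{pocket = (W,N)} · P_{delV W w}(⋃_{a ∈ N} {a ↔ b})`.
* `stub_replicaEntrance` (XL, THE BET; implies KN Conj 1 on level sets): `0 ≤ Σ_{W,N} μ{pocket_s = (W,N)} · (Z(W,N) − m(N))`.
* `firstContactBound` (proved from the three) and `AdditiveGluing_of : …PercNearOneGluing.AdditiveGluing` (proved).
-/

noncomputable section

namespace Summit.CriticalPhenomena.PercolationContinuityZ3.Cruxes.AdditiveGluing.ReplicaSpliceAtEntrance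

open MeasureTheory Literature.Probability.LatticeModels Literature.Probability.Percolation
open scoped Classical BigOperators

variable {n : ℕ}

/-! ### Vocabulary of the line (transparent packaging over existing declarations) -/

/-- `G ∖ W`: the weight of every pair meeting the vertex set `W` is set to `0`. -/
def delV (W : Finset (Fin n)) (w : Sym2 (Fin n) → unitInterval) : Sym2 (Fin n) → unitInterval :=
  fun e => if ∃ v ∈ W, v ∈ e then 0 else w e

/-- Reliability `ρ(a) = P(a ↔ b)`. -/
def rel (w : Sym2 (Fin n) → unitInterval) (a b : Fin n) : ℝ :=
  (prodBernoulli w).real (openConn a b)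

/-- The superlevel set / reliability ball `A_s = {v | ρ(v) ≥ s}` (`∋ b` when `s ≤ 1`). -/
def levelSet (w : Sym2 (Fin n) → unitInterval) (b : Fin n) (s : ℝ) : Finset (Fin n) :=
  Finset.univ.filter fun v => s ≤ rel w v b

/-- The `A`-AVOIDING POCKET of `o`: the vertices joined to `o` by an open path all of whose vertices lie
outside `A` (`= ∅` if `o ∈ A`, `∋ o` otherwise). -/
def pocket (A : Finset (Fin n)) (o : Fin n) (ω : BondConfig (Fin n)) : Finset (Fin n) :=
  Finset.univ.filter fun v => ω ∈ openConnIn ((↑A : Set (Fin n))ᶜ) o v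

/-- The ENTRANCE SET (first contacts) `N(ω) ⊆ A`: the points of `A` reached from `o` by an open path meeting
`A` only at its endpoint (`= {o}` if `o ∈ A`). -/
def contacts (A : Finset (Fin n)) (o : Fin n) (ω : BondConfig (Fin n)) : Finset (Fin n) :=
  A.filter fun a => ω ∈ openConnIn (insert a ((↑A : Set (Fin n))ᶜ)) o a

/-- The pocket data `(W, N)` revealed by the exploration of `C(o)` stopped at its entrance into `A`. -/
def pocketData (A : Finset (Fin n)) (o : Fin n) (ω : BondConfig (Fin n)) :
    Finset (Fin n) × Finset (Fin n) :=
  (pocket A o ω, contacts A o ω)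

/-- The event "the pocket is `W` and the entrance set is `N`". -/
def pocketEvent (A : Finset (Fin n)) (o : Fin n) (W N : Finset (Fin n)) : Set (BondConfig (Fin n)) :=
  {ω | pocket A o ω = W ∧ contacts A o ω = N}

/-- "Some first contact reaches `b` OFF the pocket": `⋃_{a ∈ N} {a ↔ b inside Wᶜ}` (an event of the pairs
not meeting `W`). -/
def offPocketConn (W N : Finset (Fin n)) (b : Fin n) : Set (BondConfig (Fin n)) :=
  ⋃ a ∈ N, openConnIn ((↑W : Set (Fin n))ᶜ) a b

/-- `m(N) = min_{a ∈ N} ρ(a)`, the reliability of the WORST first contact (`0` for `N = ∅`). -/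
def minRel (w : Sym2 (Fin n) → unitInterval) (b : Fin n) (N : Finset (Fin n)) : ℝ :=
  if h : N.Nonempty then N.inf' h (fun a => rel w a b) else 0

/-! ### Registered stubs -/

/-- **stub_lastExitCut** (size M; combinatorics of open walks; sources: KozmaNitzan2024 = arXiv:2401.12397 §3.2
(proof of Thm 5, p.14: "there is no big difference between conditioning on `σ_{x}` and simply deleting `0`"),
Grimmett1999 §1.3). On the event that the `A`-avoiding pocket of `o` is `W` with entrance set `N`, `o ↔ b` holds
iff some first contact is joined to `b` by an open path avoiding `W`: (⇒) follow an open walk from `o ∈ W` to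
`b ∉ W` (`b ∈ A`, `W ⊆ Aᶜ`) and cut it at its LAST exit from `W` — the exit pair `{x, y}`, `x ∈ W`, is open, so
`y ∉ Aᶜ ∖ W` (else `y` would be in the pocket), i.e. `y ∈ A`, i.e. `y ∈ N`, and the remainder avoids `W`;
(⇐) `a ∈ N` is joined to `o`. Degenerate data (`W` not a pocket, `o ∈ A` with `(W,N) = (∅,{o})` where
`openConnIn univ = openConn`) are covered by the same statement. -/
theorem stub_lastExitCut :
    ∀ (n : ℕ) (A : Finset (Fin n)) (o b : Fin n), b ∈ A → ∀ (W N : Finset (Fin n)),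
      pocketEvent A o W N ∩ openConn o b = pocketEvent A o W N ∩ offPocketConn W N b := by
  sorry

/-- **stub_pocketMarkov** (size M–L; product-measure calculus; sources: Gladkov2024 = arXiv:2408.08457 Lemma 3.1
(= Gladkov–Zimin 2024 Lemma 4.2: the splice `C₁ →_S C₂` at a tree-built set `S` has law `μ`), vdBHK 2006
Lemma 2.3 ("given `C_A = F` the configuration off `F̄` is percolation on `G − F̄`"), tree:
`prodBernoulli_real_inter_of_determinedBy` / `_disjoint` (ProdBernoulliIndependence.lean),
`prodBernoulli_real_eq_of_determinedBy` (ProdBernoulliClusterLocality.lean), `prodBernoulli_ae_notMem`).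
**Spatial Markov property at the entrance stopping set.** The event `{pocket = W, N}` is determined by the pairs
MEETING `W` (membership of `v ∈ W` is witnessed by open paths inside `W`; non-membership of the rest of `Aᶜ` and
the value of `N` by the states of the pairs leaving `W`), the event `offPocketConn W N b` by the pairs inside `Wᶜ`;
hence they are independent under the product measure, and the law of the pairs off `W` is the same under `w` and
under `delV W w`, under which `⋃_{a∈N} openConn a b = offPocketConn W N b` a.s. (pairs meeting `W` are a.s. closed;
the degenerate `N ∩ W ≠ ∅` or `b ∈ W` only occur with `μ{pocket = W, N} = 0`). -/
theorem stub_pocketMarkov :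
    ∀ (n : ℕ) (w : Sym2 (Fin n) → unitInterval) (A : Finset (Fin n)) (o b : Fin n) (W N : Finset (Fin n)),
      (prodBernoulli w).real (pocketEvent A o W N ∩ offPocketConn W N b) =
        (prodBernoulli w).real (pocketEvent A o W N) *
          (prodBernoulli (delV W w)).real (⋃ a ∈ N, openConn a b) := by
  sorry

/-- **stub_replicaEntrance** — THE LOAD-BEARING STUB (size XL, open-problem grade: it implies Kozma–Nitzan
Conjecture 1 on superlevel sets, hence the crux; sources: KozmaNitzan2024 = arXiv:2401.12397 Conj 1 p.3, §5.6(4)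
p.37 (level sets WLOG), Question 7 p.36 (same exchange SHAPE with a fixed relay in ONE configuration), Thm 4 / Lemma 5
pp.12–13 (the `W = {o}` pocket); Gladkov2024 = arXiv:2408.08457 Lemma 3.1, Thm 3.2 (decision-tree Harris), Thm 4.3
(swap-at-`e` induction); idea card replica-splice-at-entrance; triage r1-2 "first lemma = a Cost bound false for
digraphs"). **Averaged entrance inequality, two-replica form.** For the superlevel set `A = A_s` and every `o`:
`0 ≤ Σ_{W,N} μ{pocket = W, contacts = N} · ( P_{G∖W}(N ↔ b) − min_{a∈N} ρ(a) )`
(terms with `N = ∅` vanish). Equivalently, for independent `ω₁, ω₂ ∼ μ`: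
`P⊗P[ a_{N(ω₁)} ↔ b in ω₂ ] ≤ P⊗P[ N(ω₁) ↔ b in ω₂ without crossing W(ω₁) ]` ("Cost ≤ Gain"), and, after
cancelling the common part, `P⊗P[o ↔₁ A, o ↮₁ b, a_{N₁} ↔₂ b] ≤ P⊗P[o ↔₁ b, a_{N₁} ↮₂ b]` — KN's Question-7 exchange
shape with the relay chosen configuration-wise (worst FIRST CONTACT) and evaluated in a REPLICA. One relay besides `b`:
Harris. Pointwise in `(W,N)` it is false (dead pockets: `W = {o}` with `o`'s non-`A` edges closed), per-`W` it is false,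
with `max_N` in place of `min_N` it is false, for digraphs it is false (KN Fig. 4: 15/32 > 14/32): the proof must move
mass ACROSS pockets by opening the scar edge met by the replica path (swap involution, weight-preserving, grows the
pocket only because edges are unoriented). Why it might fail: it is strictly stronger than KN Conj 1 (open; KN Thm 1–2
cover |A| = 2 and special |A| = 3 only); a bunkbed-type gadget (arXiv:2410.02545) making the worst first contact
systematically better connected THROUGH the pocket than the other contacts are AROUND it would break it. Exact
enumeration (planner): 0 violations in ≈ 35 000 instances n ≤ 8 (general `A`, all weight regimes) + ≈ 300 adversarial
hill-climbs (inf rel. slack → 0⁺ only at `o ≡ relay`). The general-`A` form (any `A ∋ b`) passed the same tests and is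
the natural induction-friendly target; only the level-set form is registered. -/
theorem stub_replicaEntrance :
    ∀ (n : ℕ) (w : Sym2 (Fin n) → unitInterval) (o b : Fin n) (s : ℝ),
      0 ≤ ∑ W : Finset (Fin n), ∑ N : Finset (Fin n),
        (prodBernoulli w).real (pocketEvent (levelSet w b s) o W N) *
          ((prodBernoulli (delV W w)).real (⋃ a ∈ N, openConn a b) - minRel w b N) := by
  sorry

/-! ### Proved bookkeeping: measurability, partition by pocket data, first entrance -/

/-- Every event of the finite configuration space is measurable. -/
theorem measurableSet_of_fin (s : Set (BondConfig (Fin n))) : MeasurableSet s :=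
  s.toFinite.measurableSet

/-- Partition of an event by the pocket data: `μ(E) = Σ_{W,N} μ({pocket = W, N} ∩ E)`. -/
theorem measureReal_eq_sum_pocketEvent (w : Sym2 (Fin n) → unitInterval) (A : Finset (Fin n))
    (o : Fin n) (E : Set (BondConfig (Fin n))) :
    (prodBernoulli w).real E =
      ∑ W : Finset (Fin n), ∑ N : Finset (Fin n), (prodBernoulli w).real (pocketEvent A o W N ∩ E) := by
  have h1 : ∀ v : Finset (Fin n) × Finset (Fin n),
      MeasurableSet (pocketData A o ⁻¹' {v}) := fun v => measurableSet_of_fin _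
  have h := sum_measureReal_preimage_singleton (μ := (prodBernoulli w).restrict E)
    (Finset.univ : Finset (Finset (Fin n) × Finset (Fin n))) (f := pocketData A o) (fun v _ => h1 v)
  rw [Finset.coe_univ, Set.preimage_univ, measureReal_restrict_apply MeasurableSet.univ,
    Set.univ_inter] at h
  rw [← h, Fintype.sum_prod_type]
  refine Finset.sum_congr rfl fun W _ => Finset.sum_congr rfl fun N _ => ?_
  rw [measureReal_restrict_apply (h1 _)]
  congr 1
  ext ω
  simp only [Set.mem_inter_iff, Set.mem_preimage, Set.mem_singleton_iff, pocketData, pocketEvent,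
    Prod.ext_iff, Set.mem_setOf_eq]

/-- FIRST ENTRANCE: an open path from `o` to a point of `A` meets `A` a first time, so `o ↔ a`, `a ∈ A` imply
`N(ω) ≠ ∅` (induction on an open walk). -/
theorem contacts_nonempty_of_mem_openConn (A : Finset (Fin n)) (o a : Fin n) (ha : a ∈ A)
    (ω : BondConfig (Fin n)) (h : ω ∈ openConn o a) : (contacts A o ω).Nonempty := by
  have key : ∀ (u x : Fin n) (p : (openGraph ω).Walk u x), x ∈ A →
      ∃ a' ∈ A, ω ∈ openConnIn (insert a' ((↑A : Set (Fin n))ᶜ)) u a' := by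
    intro u x p
    induction p with
    | nil =>
      intro hx
      exact ⟨_, hx, Set.mem_insert _ _, Set.mem_insert _ _, SimpleGraph.Reachable.refl _⟩
    | @cons u v x hadj p ih =>
      intro hx
      by_cases hu : u ∈ A
      · exact ⟨u, hu, Set.mem_insert _ _, Set.mem_insert _ _, SimpleGraph.Reachable.refl _⟩
      · obtain ⟨a', ha', hv, hy, hreach⟩ := ih hx
        have hu' : u ∈ insert a' ((↑A : Set (Fin n))ᶜ) :=
          Set.mem_insert_of_mem _ (by simpa using hu)
        refine ⟨a', ha', hu', hy, SimpleGraph.Reachable.trans ?_ hreach⟩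
        refine SimpleGraph.Adj.reachable ?_
        simp only [SimpleGraph.induce, SimpleGraph.comap_adj, Function.Embedding.coe_subtype]
        exact hadj
  obtain ⟨p⟩ := h
  obtain ⟨a', ha', hmem⟩ := key o a p ha
  exact ⟨a', Finset.mem_filter.2 ⟨ha', hmem⟩⟩

/-- `N ⊆ A`. -/
theorem contacts_subset (A : Finset (Fin n)) (o : Fin n) (ω : BondConfig (Fin n)) :
    contacts A o ω ⊆ A := Finset.filter_subset _ _

/-- `μ(o ↔ A) ≤ μ(N ≠ ∅)`. -/
theorem measureReal_openConn_le_contacts (w : Sym2 (Fin n) → unitInterval) (A : Finset (Fin n))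
    (o : Fin n) :
    (prodBernoulli w).real (⋃ a ∈ A, openConn o a) ≤
      (prodBernoulli w).real {ω | (contacts A o ω).Nonempty} := by
  refine measureReal_mono ?_ (measure_ne_top _ _)
  intro ω hω
  simp only [Set.mem_iUnion, exists_prop] at hω
  obtain ⟨a, ha, h⟩ := hω
  exact contacts_nonempty_of_mem_openConn A o a ha ω h

/-- `c · μ(N ≠ ∅)` as a sum over pocket data. -/
theorem sum_pocketEvent_nonempty (w : Sym2 (Fin n) → unitInterval) (A : Finset (Fin n))
    (o : Fin n) (c : ℝ) :
    ∑ W : Finset (Fin n), ∑ N : Finset (Fin n),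
        (prodBernoulli w).real (pocketEvent A o W N) * (if N.Nonempty then c else 0) =
      c * (prodBernoulli w).real {ω | (contacts A o ω).Nonempty} := by
  rw [measureReal_eq_sum_pocketEvent w A o {ω | (contacts A o ω).Nonempty}, Finset.mul_sum]
  refine Finset.sum_congr rfl fun W _ => ?_
  rw [Finset.mul_sum]
  refine Finset.sum_congr rfl fun N _ => ?_
  by_cases hN : N.Nonempty
  · rw [if_pos hN, mul_comm]
    have hset : pocketEvent A o W N ∩ {ω | (contacts A o ω).Nonempty} = pocketEvent A o W N := by
      ext ω
      simp only [pocketEvent, Set.mem_inter_iff, Set.mem_setOf_eq]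
      constructor
      · rintro ⟨h, -⟩
        exact h
      · intro h
        refine ⟨h, ?_⟩
        rw [h.2]
        exact hN
    rw [hset]
  · rw [if_neg hN, mul_zero]
    have : pocketEvent A o W N ∩ {ω | (contacts A o ω).Nonempty} = ∅ := by
      ext ω
      simp only [pocketEvent, Set.mem_inter_iff, Set.mem_setOf_eq, Set.mem_empty_iff_false,
        iff_false, not_and]
      rintro ⟨-, rfl⟩
      exact hN
    rw [this, measureReal_empty, mul_zero]

/-- `ρ(b) = 1`. -/
theorem rel_self (w : Sym2 (Fin n) → unitInterval) (b : Fin n) : rel w b b = 1 := by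
  have : (openConn b b : Set (BondConfig (Fin n))) = Set.univ :=
    Set.eq_univ_iff_forall.2 fun ω => SimpleGraph.Reachable.refl _
  simp only [rel, this, probReal_univ]

/-! ### The first-contact bound (the C⁺ of the line) and the composition -/

/-- **First-contact bound** (from the three stubs; KN Conjecture 1 on level sets with the minimum over FIRST CONTACTS):
`Σ_{W,N} μ{pocket_s = W, N} · min_{a∈N} ρ(a) ≤ P(o ↔ b)` for every level `s ≤ 1`. -/
theorem firstContactBound (n : ℕ) (w : Sym2 (Fin n) → unitInterval) (o b : Fin n) (s : ℝ) (hs : s ≤ 1) :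
    ∑ W : Finset (Fin n), ∑ N : Finset (Fin n),
        (prodBernoulli w).real (pocketEvent (levelSet w b s) o W N) * minRel w b N ≤
      (prodBernoulli w).real (openConn o b) := by
  set A := levelSet w b s with hA
  have hb : b ∈ A := by
    rw [hA, levelSet, Finset.mem_filter]
    exact ⟨Finset.mem_univ _, by rw [rel_self]; exact hs⟩
  have hC := stub_lastExitCut n A o b hb
  have hM := stub_pocketMarkov n w A o b
  have hR := stub_replicaEntrance n w o b s
  rw [measureReal_eq_sum_pocketEvent w A o (openConn o b)]
  have hsplit : ∑ W : Finset (Fin n), ∑ N : Finset (Fin n),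
      (prodBernoulli w).real (pocketEvent A o W N) *
        ((prodBernoulli (delV W w)).real (⋃ a ∈ N, openConn a b) - minRel w b N) =
      (∑ W : Finset (Fin n), ∑ N : Finset (Fin n),
        (prodBernoulli w).real (pocketEvent A o W N ∩ openConn o b)) -
      ∑ W : Finset (Fin n), ∑ N : Finset (Fin n),
        (prodBernoulli w).real (pocketEvent A o W N) * minRel w b N := by
    rw [← Finset.sum_sub_distrib]
    refine Finset.sum_congr rfl fun W _ => ?_
    rw [← Finset.sum_sub_distrib]
    refine Finset.sum_congr rfl fun N _ => ?_
    rw [hC W N, hM W N, mul_sub]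
  rw [← hA] at hR
  rw [hsplit] at hR
  linarith

/-- **Composition.** The three stubs imply the crux `AdditiveGluing` BY NAME. Real proof: for `t ≥ 1` the claim is
`P(o ↔ A) − t ≤ 0 ≤ P(o ↔ b)`; for `0 ≤ t < 1` take the ball `A' = A_{1−t} ⊇ A ∪ {b}` (the relay hypothesis and
`ρ(b) = 1 ≥ 1 − t`); then `P(o ↔ A) − t ≤ (1−t) P(o ↔ A) ≤ (1−t) μ(N' ≠ ∅)` (first entrance)
`= Σ_{W,N ≠ ∅} μ{pocket' = W, N} (1−t) ≤ Σ_{W,N} μ{pocket' = W, N} · min_N ρ` (`min_N ρ ≥ 1 − t` on `N ⊆ A'`)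
`≤ P(o ↔ b)` (`firstContactBound`). -/
theorem AdditiveGluing_of :
    Summit.CriticalPhenomena.PercolationContinuityZ3.Theses.PercNearOneGluing.AdditiveGluing := by
  intro n w A o b t ht hA
  set μ := prodBernoulli w with hμ
  -- trivial when t ≥ 1
  rcases le_or_gt 1 t with ht1 | ht1
  · have h1 : μ.real (⋃ a ∈ A, openConn o a) ≤ 1 := measureReal_le_one
    have h2 : 0 ≤ μ.real (openConn o b) := measureReal_nonneg
    linarith
  -- the ball `A' = A_{1-t}` contains `A` and `b`
  set A' : Finset (Fin n) := levelSet w b (1 - t) with hA'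
  have hsub : A ⊆ A' := by
    intro a ha
    rw [hA', levelSet, Finset.mem_filter]
    exact ⟨Finset.mem_univ _, hA a ha⟩
  -- (1) monotonicity in the relay set and the first-entrance inclusion
  have hmonoA : μ.real (⋃ a ∈ A, openConn o a) ≤ μ.real (⋃ a ∈ A', openConn o a) := by
    refine measureReal_mono ?_ (measure_ne_top _ _)
    exact Set.biUnion_subset_biUnion_left fun a ha => hsub ha
  have hcont := measureReal_openConn_le_contacts w A' o
  set q := μ.real {ω | (contacts A' o ω).Nonempty} with hq
  -- (2) termwise: (1 - t)·1{N ≠ ∅} ≤ min_N ρ on pocket events of positive mass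
  have hterm : ∀ W N : Finset (Fin n),
      μ.real (pocketEvent A' o W N) * (if N.Nonempty then (1 - t) else 0) ≤
        μ.real (pocketEvent A' o W N) * minRel w b N := by
    intro W N
    by_cases hN : N.Nonempty
    · rw [if_pos hN]
      by_cases hNA : N ⊆ A'
      · refine mul_le_mul_of_nonneg_left ?_ measureReal_nonneg
        rw [minRel, dif_pos hN]
        refine Finset.le_inf' hN _ fun a ha => ?_
        have := hNA ha
        rw [hA', levelSet, Finset.mem_filter] at this
        exact this.2
      · have hempty : pocketEvent A' o W N = ∅ := by
          ext ω
          simp only [pocketEvent, Set.mem_setOf_eq, Set.mem_empty_iff_false, iff_false, not_and]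
          rintro - rfl
          exact hNA (contacts_subset A' o ω)
        simp [hempty]
    · rw [if_neg hN, minRel, dif_neg hN]
  have hsum : (1 - t) * q ≤ ∑ W : Finset (Fin n), ∑ N : Finset (Fin n),
      μ.real (pocketEvent A' o W N) * minRel w b N := by
    rw [hq, ← sum_pocketEvent_nonempty w A' o (1 - t)]
    exact Finset.sum_le_sum fun W _ => Finset.sum_le_sum fun N _ => hterm W N
  have hfc := firstContactBound n w o b (1 - t) (by linarith)
  -- (3) assemble
  have hPA1 : μ.real (⋃ a ∈ A, openConn o a) ≤ 1 := measureReal_le_one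
  have hq1 : μ.real (⋃ a ∈ A, openConn o a) ≤ q := hmonoA.trans hcont
  have h1t : 0 ≤ 1 - t := by linarith
  calc μ.real (⋃ a ∈ A, openConn o a) - t
      ≤ (1 - t) * μ.real (⋃ a ∈ A, openConn o a) := by nlinarith
    _ ≤ (1 - t) * q := mul_le_mul_of_nonneg_left hq1 h1t
    _ ≤ _ := hsum
    _ ≤ μ.real (openConn o b) := hfc

end Summit.CriticalPhenomena.PercolationContinuityZ3.Cruxes.AdditiveGluing.ReplicaSpliceAtEntrance

end
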